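import Literature.NumberTheory.Transcendental.NesterenkoCoeffNorms
import Mathlib.RingTheory.MvPolynomial.EulerIdentity
import HarnessLib

/-!
# Roy's small value estimate for `𝔾ₐ × 𝔾ₘ` — the basic objects of §3 and Lemma 3.1

Topic `Literature/NumberTheory/Transcendental`. First instalment of the formalisation of the PROOF
of Roy 2013, Theorem 1.1 (the named fact `roy2013_thm_1_1` of `RoySmallValueEstimates.lean`),
following the printed argument (D. Roy, *A small value estimate for `𝔾ₐ × 𝔾ₘ`*, Mathematika 59
(2013) 333–363 = arXiv:1301.0663, §3 "Basic estimates", p. 8 of the arXiv text).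

Roy works in `ℂ[X] = ℂ[X₀, X₁, X₂]` with

* the homogeneous `𝒢`-invariant derivation `𝒟 = X₀ ∂/∂X₁ + X₂ ∂/∂X₂` — `homD` (a `Derivation`);
* for `γ = (ξ, η) ∈ 𝒢 = ℂ × ℂˣ` the algebra automorphism
  `τ_γ P (X₀, X₁, X₂) = P(X₀, ξ X₀ + X₁, η X₂)` — `tau ξ η` (an `AlgHom`), so that
  `(τ_γ P)(1, γ') = P(1, γ + γ')` for the group law `(ξ, η) + (ξ', η') = (ξ + ξ', η η')`
  (`aeval_one_tau`), `τ_γ ∘ 𝒟 = 𝒟 ∘ τ_γ` (`tau_homD`) and `τ_γ ∘ τ_γ' = τ_{γ+γ'}` (`tau_tau`);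
* the value `P(1, γ) = P(1, ξ, η)` — written `aeval ![1, ξ, η] P` throughout;
* the length `𝓛(Q)` = sum of the moduli of the coefficients — the tree's `Nesterenko.l1Norm`, and
  the norm `‖Q‖` = largest modulus of a coefficient — the tree's `Nesterenko.maxNorm`.

**Lemma 3.1** (Roy 2013, p. 8): for `Q ∈ ℂ[X]_D`, `γ = (ξ, η)`, `i ∈ ℕ`,
`𝓛(τ_γ Q) ≤ c₁(γ)^D ‖Q‖`, `𝓛(𝒟^i Q) ≤ D^i 𝓛(Q)`, `|𝒟^i Q(1, γ)| ≤ c₂(γ)^D D^i 𝓛(Q)` with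
`c₁(γ) = 2 + |ξ| + |η|`, `c₂(γ) = max{1, |ξ|, |η|}`. Here: `l1Norm_iterate_homD_le` (second
estimate, as printed), `norm_aeval_iterate_homD_le` (third, as printed), and the first in the
`ℓ¹`-form `𝓛(τ_γ Q) ≤ (1 + |ξ| + |η|)^D 𝓛(Q)` (`l1Norm_tau_le`), valid for every `Q` of total degree
`≤ D`; since `‖Q‖ ≤ 𝓛(Q) ≤ 3^D ‖Q‖` on `ℂ[X]_D` this is the printed estimate up to the harmless
replacement of `c₁(γ)` by `3(1 + |ξ| + |η|)` (`l1Norm_tau_le_maxNorm`); only the shape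
`c^D`, `c = c(γ)`, matters downstream (Propositions 3.3, 3.7, 6.1 of the paper).

Everything here is proved; no new named facts.

## References

* [Roy2013] D. Roy, *A small value estimate for 𝔾ₐ × 𝔾ₘ*, Mathematika 59 (2013), 333–363
  (arXiv:1301.0663), §3, Lemma 3.1.
-/

noncomputable section

open MvPolynomial

namespace Literature.NumberTheory.Transcendental

namespace Roy2013

open Nesterenko

/-- `ℂ[X] = ℂ[X₀, X₁, X₂]`. [cite: Roy2013, §3 (p. 8)] -/
abbrev CX : Type := MvPolynomial (Fin 3) ℂ

/-! ### The derivation `𝒟` -/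

/-- Roy's homogeneous derivation `𝒟 = X₀ ∂/∂X₁ + X₂ ∂/∂X₂` of `ℂ[X₀, X₁, X₂]` (the homogeneous
version of `𝒟₁ = ∂/∂X₁ + X₂ ∂/∂X₂`). [cite: Roy2013, §3 (p. 8)] -/
def homD : Derivation ℂ CX CX := (X 0 : CX) • pderiv 1 + (X 2 : CX) • pderiv 2

/-- `𝒟 P = X₀ ∂P/∂X₁ + X₂ ∂P/∂X₂`. [cite: Roy2013, §3 (p. 8)] -/
theorem homD_apply (P : CX) : homD P = X 0 * pderiv 1 P + X 2 * pderiv 2 P := by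
  simp only [homD, Derivation.coe_add, Derivation.coe_smul, Pi.add_apply, Pi.smul_apply,
    smul_eq_mul]

/-- `𝒟 X₀ = 0`. [cite: Roy2013, §3 (p. 8)] -/
@[simp] theorem homD_X_zero : homD (X 0 : CX) = 0 := by
  rw [homD_apply, pderiv_X_of_ne (by decide), pderiv_X_of_ne (by decide), mul_zero, mul_zero,
    add_zero]

/-- `𝒟 X₁ = X₀`. [cite: Roy2013, §3 (p. 8)] -/
@[simp] theorem homD_X_one : homD (X 1 : CX) = X 0 := by
  rw [homD_apply, pderiv_X_self, pderiv_X_of_ne (by decide), mul_one, mul_zero, add_zero]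

/-- `𝒟 X₂ = X₂`. [cite: Roy2013, §3 (p. 8)] -/
@[simp] theorem homD_X_two : homD (X 2 : CX) = X 2 := by
  rw [homD_apply, pderiv_X_of_ne (by decide), pderiv_X_self, mul_zero, mul_one, zero_add]

/-- `𝒟` kills constants. [folklore] -/
@[simp] theorem homD_C (a : ℂ) : homD (C a : CX) = 0 := by
  rw [homD_apply, pderiv_C, pderiv_C, mul_zero, mul_zero, add_zero]

/-- `𝒟` on monomials: `𝒟(a X^ν) = ν₁ a X^{ν - e₁ + e₀} + ν₂ a X^ν`. [cite: Roy2013, §3 (p. 8)] -/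
theorem homD_monomial (ν : Fin 3 →₀ ℕ) (a : ℂ) :
    homD (monomial ν a) =
      monomial (Finsupp.single 0 1 + (ν - Finsupp.single 1 1)) (a * ν 1) +
        monomial ν (a * ν 2) := by
  rw [homD_apply, X_mul_pderiv_monomial, pderiv_monomial, X, monomial_mul, one_mul,
    smul_monomial, nsmul_eq_mul, mul_comm (ν 2 : ℂ) a]

/-- `𝒟` maps `ℂ[X]_D` to itself. [cite: Roy2013, §3 (p. 8)] -/
theorem isHomogeneous_homD {P : CX} {D : ℕ} (hP : P.IsHomogeneous D) :
    (homD P).IsHomogeneous D := by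
  rcases Nat.eq_zero_or_pos D with rfl | hD
  · rw [← totalDegree_zero_iff_isHomogeneous, totalDegree_eq_zero_iff_eq_C] at hP
    rw [hP, homD_C]
    exact isHomogeneous_zero _ _ _
  · rw [homD_apply]
    have h1 := (isHomogeneous_X ℂ (0 : Fin 3)).mul (hP.pderiv (i := 1))
    have h2 := (isHomogeneous_X ℂ (2 : Fin 3)).mul (hP.pderiv (i := 2))
    rw [show 1 + (D - 1) = D by omega] at h1 h2
    exact h1.add h2

/-- `𝒟^i` maps `ℂ[X]_D` to itself. [cite: Roy2013, §3 (p. 8)] -/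
theorem isHomogeneous_iterate_homD {P : CX} {D : ℕ} (hP : P.IsHomogeneous D) (i : ℕ) :
    (homD^[i] P).IsHomogeneous D := by
  induction i with
  | zero => exact hP
  | succ i ih => rw [Function.iterate_succ_apply']; exact isHomogeneous_homD ih

/-- **Lemma 3.1, second estimate (one step)**: `𝓛(𝒟 Q) ≤ D 𝓛(Q)` for `Q` of total degree `≤ D`.
[cite: Roy2013, Lemma 3.1] -/
theorem l1Norm_homD_le {Q : CX} {D : ℕ} (hQ : Q.totalDegree ≤ D) :
    l1Norm (homD Q) ≤ D * l1Norm Q := by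
  classical
  conv_lhs => rw [Q.as_sum, map_sum]
  refine (l1Norm_sum_le _ _).trans ?_
  rw [l1Norm, Finset.mul_sum]
  refine Finset.sum_le_sum fun ν hν => ?_
  rw [homD_monomial]
  refine (l1Norm_add_le _ _).trans ?_
  rw [l1Norm_monomial, l1Norm_monomial, norm_mul, norm_mul, Complex.norm_natCast,
    Complex.norm_natCast, ← mul_add, mul_comm]
  refine mul_le_mul_of_nonneg_right ?_ (norm_nonneg _)
  have hdeg : (ν.sum fun _ e => e) ≤ D := (le_totalDegree hν).trans hQ
  rw [Finsupp.sum_fintype _ _ (by simp), Fin.sum_univ_three] at hdeg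
  exact_mod_cast (show ν 1 + ν 2 ≤ D by omega)

/-- **Lemma 3.1, second estimate**: `𝓛(𝒟^i Q) ≤ D^i 𝓛(Q)` for `Q ∈ ℂ[X]_D`.
[cite: Roy2013, Lemma 3.1] -/
theorem l1Norm_iterate_homD_le {Q : CX} {D : ℕ} (hQ : Q.IsHomogeneous D) (i : ℕ) :
    l1Norm (homD^[i] Q) ≤ (D : ℝ) ^ i * l1Norm Q := by
  induction i with
  | zero => simp
  | succ i ih =>
    rw [Function.iterate_succ_apply', pow_succ, mul_comm ((D : ℝ) ^ i), mul_assoc]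
    refine (l1Norm_homD_le (isHomogeneous_iterate_homD hQ i).totalDegree_le).trans ?_
    exact mul_le_mul_of_nonneg_left ih (Nat.cast_nonneg _)

/-! ### Values at `(1, γ)` -/

/-- `|Q(1, ξ, η)| ≤ c₂^D 𝓛(Q)` with `c₂ = max{1, |ξ|, |η|}`, for `Q` of total degree `≤ D`.
[cite: Roy2013, Lemma 3.1 (proof)] -/
theorem norm_aeval_one_le {Q : CX} {D : ℕ} (hQ : Q.totalDegree ≤ D) (ξ η : ℂ) :
    ‖aeval ![1, ξ, η] Q‖ ≤ (max 1 (max ‖ξ‖ ‖η‖)) ^ D * l1Norm Q := by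
  classical
  set c : ℝ := max 1 (max ‖ξ‖ ‖η‖) with hc
  have hc1 : 1 ≤ c := le_max_left _ _
  have hv : ∀ j : Fin 3, ‖(![1, ξ, η] : Fin 3 → ℂ) j‖ ≤ c := by
    intro j
    fin_cases j
    · simp [hc]
    · exact (le_max_left _ _).trans (le_max_right _ _)
    · exact (le_max_right _ _).trans (le_max_right _ _)
  change ‖eval ![1, ξ, η] Q‖ ≤ c ^ D * l1Norm Q
  rw [eval_eq', l1Norm, Finset.mul_sum]
  refine (norm_sum_le _ _).trans (Finset.sum_le_sum fun ν hν => ?_)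
  rw [norm_mul, mul_comm]
  refine mul_le_mul_of_nonneg_right ?_ (norm_nonneg _)
  have hdeg : (ν.sum fun _ e => e) ≤ D := (le_totalDegree hν).trans hQ
  rw [Finsupp.sum_fintype _ _ (by simp)] at hdeg
  calc ‖∏ j, (![1, ξ, η] : Fin 3 → ℂ) j ^ ν j‖ = ∏ j, ‖(![1, ξ, η] : Fin 3 → ℂ) j‖ ^ ν j := by
        rw [norm_prod]; simp_rw [norm_pow]
    _ ≤ ∏ j, c ^ ν j := Finset.prod_le_prod (fun j _ => by positivity)
        fun j _ => pow_le_pow_left₀ (norm_nonneg _) (hv j) _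
    _ = c ^ ∑ j, ν j := (Finset.prod_pow_eq_pow_sum _ _ _)
    _ ≤ c ^ D := pow_le_pow_right₀ hc1 hdeg

/-- **Lemma 3.1, third estimate**: `|𝒟^i Q(1, γ)| ≤ c₂(γ)^D D^i 𝓛(Q)` for `Q ∈ ℂ[X]_D`,
`c₂(γ) = max{1, |ξ|, |η|}`. [cite: Roy2013, Lemma 3.1] -/
theorem norm_aeval_iterate_homD_le {Q : CX} {D : ℕ} (hQ : Q.IsHomogeneous D) (ξ η : ℂ) (i : ℕ) :
    ‖aeval ![1, ξ, η] (homD^[i] Q)‖ ≤ (max 1 (max ‖ξ‖ ‖η‖)) ^ D * (D : ℝ) ^ i * l1Norm Q := by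
  refine (norm_aeval_one_le (isHomogeneous_iterate_homD hQ i).totalDegree_le ξ η).trans ?_
  rw [mul_assoc]
  exact mul_le_mul_of_nonneg_left (l1Norm_iterate_homD_le hQ i) (by positivity)

/-! ### The translations `τ_γ` -/

/-- Roy's translation automorphism `τ_γ P = P(X₀, ξ X₀ + X₁, η X₂)` for `γ = (ξ, η)`.
[cite: Roy2013, §3 (p. 8)] -/
def tau (ξ η : ℂ) : CX →ₐ[ℂ] CX := aeval ![X 0, C ξ * X 0 + X 1, C η * X 2]

/-- `τ_γ X₀ = X₀`. [cite: Roy2013, §3 (p. 8)] -/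
@[simp] theorem tau_X_zero (ξ η : ℂ) : tau ξ η (X 0) = X 0 := by
  simp [tau]

/-- `τ_γ X₁ = ξ X₀ + X₁`. [cite: Roy2013, §3 (p. 8)] -/
@[simp] theorem tau_X_one (ξ η : ℂ) : tau ξ η (X 1) = C ξ * X 0 + X 1 := by
  simp [tau]

/-- `τ_γ X₂ = η X₂`. [cite: Roy2013, §3 (p. 8)] -/
@[simp] theorem tau_X_two (ξ η : ℂ) : tau ξ η (X 2) = C η * X 2 := by
  simp [tau]

/-- `(τ_γ P)(1, γ') = P(1, γ + γ')` for the group law of `𝒢 = ℂ × ℂˣ`: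
`(ξ, η) + (ξ', η') = (ξ + ξ', η η')`. [cite: Roy2013, §3 (p. 8)] -/
theorem aeval_one_tau (ξ η ξ' η' : ℂ) (P : CX) :
    aeval ![1, ξ', η'] (tau ξ η P) = aeval ![1, ξ + ξ', η * η'] P := by
  rw [tau, ← AlgHom.comp_apply]
  congr 1
  refine algHom_ext fun i => ?_
  fin_cases i
  · simp
  · simp
  · simp

/-- `τ_γ ∘ τ_γ' = τ_{γ + γ'}`. [cite: Roy2013, §3 (p. 8)] -/
theorem tau_tau (ξ η ξ' η' : ℂ) (P : CX) :
    tau ξ η (tau ξ' η' P) = tau (ξ + ξ') (η * η') P := by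
  rw [tau, tau, ← AlgHom.comp_apply]
  congr 1
  refine algHom_ext fun i => ?_
  fin_cases i <;> simp [tau] <;> ring

/-- `τ_0 = id`. [cite: Roy2013, §3 (p. 8)] -/
@[simp] theorem tau_zero_one (P : CX) : tau 0 1 P = P := by
  conv_rhs => rw [← AlgHom.id_apply (R := ℂ) P]
  rw [tau]
  congr 1
  refine algHom_ext fun i => ?_
  fin_cases i <;> simp

/-- `τ_{-γ} ∘ τ_γ = id` with `-γ = (-ξ, η⁻¹)` (`η ≠ 0`). [cite: Roy2013, §3 (p. 8)] -/
theorem tau_neg_tau {ξ η : ℂ} (hη : η ≠ 0) (P : CX) : tau (-ξ) η⁻¹ (tau ξ η P) = P := by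
  rw [tau_tau, neg_add_cancel, inv_mul_cancel₀ hη, tau_zero_one]

/-- `𝒟(C a · P) = C a · 𝒟 P`. [folklore] -/
theorem homD_C_mul (a : ℂ) (P : CX) : homD (C a * P) = C a * homD P := by
  rw [Derivation.leibniz, homD_C, smul_zero, add_zero, smul_eq_mul]

/-- `τ_γ (𝒟 Xᵢ) = 𝒟 (τ_γ Xᵢ)` for the three variables. [cite: Roy2013, §3 (p. 8)] -/
theorem tau_homD_X (ξ η : ℂ) (i : Fin 3) : tau ξ η (homD (X i)) = homD (tau ξ η (X i)) := by
  fin_cases i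
  · change tau ξ η (homD (X 0)) = homD (tau ξ η (X 0))
    rw [tau_X_zero, homD_X_zero, map_zero]
  · change tau ξ η (homD (X 1)) = homD (tau ξ η (X 1))
    rw [tau_X_one, homD_X_one, tau_X_zero, map_add, homD_C_mul, homD_X_zero, mul_zero, zero_add,
      homD_X_one]
  · change tau ξ η (homD (X 2)) = homD (tau ξ η (X 2))
    rw [tau_X_two, homD_X_two, tau_X_two, homD_C_mul, homD_X_two]

/-- `τ_γ ∘ 𝒟 = 𝒟 ∘ τ_γ`. [cite: Roy2013, §3 (p. 8)] -/
theorem tau_homD (ξ η : ℂ) (P : CX) : tau ξ η (homD P) = homD (tau ξ η P) := by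
  induction P using MvPolynomial.induction_on with
  | C a => rw [homD_C, map_zero, tau, aeval_C, ← C_eq_algebraMap, homD_C]
  | add p q hp hq => simp only [map_add, hp, hq]
  | mul_X p i hp =>
    rw [Derivation.leibniz, smul_eq_mul, smul_eq_mul, map_add, map_mul, map_mul, hp,
      tau_homD_X, map_mul, Derivation.leibniz, smul_eq_mul, smul_eq_mul]

/-- `τ_γ ∘ 𝒟^i = 𝒟^i ∘ τ_γ`. [cite: Roy2013, §3 (p. 8)] -/
theorem tau_iterate_homD (ξ η : ℂ) (P : CX) (i : ℕ) :
    tau ξ η (homD^[i] P) = homD^[i] (tau ξ η P) := by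
  induction i generalizing P with
  | zero => rfl
  | succ i ih => rw [Function.iterate_succ_apply, Function.iterate_succ_apply, ← tau_homD, ih]

/-- `τ_γ` maps `ℂ[X]_D` to itself. [cite: Roy2013, §3 (p. 8)] -/
theorem isHomogeneous_tau (ξ η : ℂ) {P : CX} {D : ℕ} (hP : P.IsHomogeneous D) :
    (tau ξ η P).IsHomogeneous D := by
  have hg : ∀ i : Fin 3, ((![X 0, C ξ * X 0 + X 1, C η * X 2] : Fin 3 → CX) i).IsHomogeneous 1 := by
    intro i
    fin_cases i
    · exact isHomogeneous_X _ _
    · exact ((isHomogeneous_X _ _).C_mul _).add (isHomogeneous_X _ _)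
    · exact (isHomogeneous_X _ _).C_mul _
  have h := hP.eval₂ (algebraMap ℂ CX) ![X 0, C ξ * X 0 + X 1, C η * X 2]
    (fun r => isHomogeneous_C _ _) hg
  rw [one_mul] at h
  rw [tau, aeval_def]
  exact h

/-- **Lemma 3.1, first estimate (`ℓ¹` form)**: `𝓛(τ_γ Q) ≤ (1 + |ξ| + |η|)^D 𝓛(Q)` for `Q` of
total degree `≤ D` (Roy: `𝓛(τ_γ Q) ≤ (2 + |ξ| + |η|)^D ‖Q‖` for `Q ∈ ℂ[X]_D`).
[cite: Roy2013, Lemma 3.1] -/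
theorem l1Norm_tau_le {Q : CX} {D : ℕ} (hQ : Q.totalDegree ≤ D) (ξ η : ℂ) :
    l1Norm (tau ξ η Q) ≤ (1 + ‖ξ‖ + ‖η‖) ^ D * l1Norm Q := by
  classical
  set c : ℝ := 1 + ‖ξ‖ + ‖η‖ with hc
  have hc1 : 1 ≤ c := by rw [hc]; nlinarith [norm_nonneg ξ, norm_nonneg η]
  have hg : ∀ j : Fin 3, l1Norm ((![X 0, C ξ * X 0 + X 1, C η * X 2] : Fin 3 → CX) j) ≤ c := by
    intro j
    fin_cases j
    · change l1Norm (X 0 : CX) ≤ c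
      rw [l1Norm_X]; exact hc1
    · change l1Norm (C ξ * X 0 + X 1 : CX) ≤ c
      refine (l1Norm_add_le _ _).trans ?_
      rw [l1Norm_X]
      refine (add_le_add_left (l1Norm_C_mul_le _ _) _).trans ?_
      rw [l1Norm_X, mul_one, hc]
      nlinarith [norm_nonneg ξ, norm_nonneg η]
    · change l1Norm (C η * X 2 : CX) ≤ c
      refine (l1Norm_C_mul_le _ _).trans ?_
      rw [l1Norm_X, mul_one, hc]
      nlinarith [norm_nonneg ξ, norm_nonneg η]
  rw [tau]
  refine (l1Norm_aeval_le_sum _ _).trans ?_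
  rw [l1Norm, Finset.mul_sum]
  refine Finset.sum_le_sum fun ν hν => ?_
  rw [mul_comm]
  refine mul_le_mul_of_nonneg_right ?_ (norm_nonneg _)
  have hdeg : (ν.sum fun _ e => e) ≤ D := (le_totalDegree hν).trans hQ
  calc ∏ j ∈ ν.support, l1Norm ((![X 0, C ξ * X 0 + X 1, C η * X 2] : Fin 3 → CX) j) ^ ν j
      ≤ ∏ j ∈ ν.support, c ^ ν j :=
        Finset.prod_le_prod (fun j _ => pow_nonneg (l1Norm_nonneg _) _)
          fun j _ => pow_le_pow_left₀ (l1Norm_nonneg _) (hg j) _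
    _ = c ^ (ν.sum fun _ e => e) := by rw [Finset.prod_pow_eq_pow_sum]; rfl
    _ ≤ c ^ D := pow_le_pow_right₀ hc1 hdeg

/-- **Lemma 3.1, first estimate (norm form)**: `𝓛(τ_γ Q) ≤ (3(1 + |ξ| + |η|))^D ‖Q‖` for
`Q ∈ ℂ[X]_D` (Roy's constant is `2 + |ξ| + |η|`; only the shape `c(γ)^D` is used later).
[cite: Roy2013, Lemma 3.1] -/
theorem l1Norm_tau_le_maxNorm {Q : CX} {D : ℕ} (hQ : Q.IsHomogeneous D) (ξ η : ℂ) :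
    l1Norm (tau ξ η Q) ≤ (3 * (1 + ‖ξ‖ + ‖η‖)) ^ D * maxNorm Q := by
  refine (l1Norm_tau_le hQ.totalDegree_le ξ η).trans ?_
  rw [mul_pow, mul_comm ((3 : ℝ) ^ D), mul_assoc]
  refine mul_le_mul_of_nonneg_left ?_ (by positivity)
  refine (l1Norm_le_card_mul_maxNorm Q).trans (mul_le_mul_of_nonneg_right ?_ (maxNorm_nonneg _))
  exact_mod_cast card_support_le_pow_of_isHomogeneous hQ

end Roy2013

end Literature.NumberTheory.Transcendental
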